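import Mathlib.Analysis.SpecialFunctions.JapaneseBracket
import Mathlib.Analysis.SpecialFunctions.Pow.NNReal
import Mathlib.MeasureTheory.Integral.MeanInequalities
import Mathlib.MeasureTheory.Measure.Haar.Unique
import Mathlib.MeasureTheory.Measure.Haar.InnerProductSpace
import Mathlib.MeasureTheory.Function.LpSeminorm.TriangleInequality
import Mathlib.MeasureTheory.Integral.Bochner.Basic
import Mathlib.Analysis.InnerProductSpace.Basic
import HarnessLib

/-!
# Weighted `L²` norms on the Fourier side, the Schur test, and kernel operators of finite order

Analysis/Hypoelliptic support file (first of the Fourier-side toolkit serving the discharge of the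
named fact `Literature.Analysis.Distribution.Hormander1967_thm11`, Hörmander's hypoellipticity
theorem for `P = ∑ X_j² + X₀ + c`, by Kohn's method as presented in M. Taylor,
*Pseudodifferential Operators* (1981), Ch. XV §1).

All the pseudo-differential calculus needed for Kohn's proof lives on the Fourier side: a
function `u` on `ℝⁿ` is replaced by `F = 𝓕u`, the Sobolev norm `‖u‖_{H^s}` by the weighted
`L²` norm `‖⟨ξ⟩^s F‖_{L²}` (`⟨ξ⟩ = (1 + |ξ|²)^{1/2}`), and the operators of the proof
(multiplication by smooth compactly supported functions, vector fields, Bessel potentials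
`⟨D⟩^s`, Friedrichs-type mollifiers `ψ(δD)`) by multipliers `F ↦ φ · F` and integral operators
`F ↦ (ξ ↦ ∫ K(ξ, η) F(η) dη)` whose kernels decay rapidly off the diagonal. This file provides

* the weights `bw s ξ = (1 + ‖ξ‖²)^{s/2}` and **Peetre's inequality**
  `bw s (ξ + η) ≤ 2^{|s|/2} bw s ξ · bw |s| η`;
* the weighted norm `wnorm s F = ‖bw s · F‖_{L²}` (an `ℝ≥0∞`, Mathlib's `eLpNorm`);
* the **Schur test** in Lebesgue-integral form: if `∫ K(ξ, η) dη ≤ A` and `∫ K(ξ, η) dξ ≤ B`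
  then `∫ (∫ K G)² ≤ A B ∫ G²`;
* kernel operators `kerOp K F (ξ) = ∫ K ξ η * F η dη`, the certificate `KerDecay K m C`
  (`‖K ξ η‖ ≤ C N · bw (-N) (ξ - η) · bw m η` for every `N`, with an explicit constant function
  `C : ℕ → ℝ`, so that families of kernels with the same `C` are automatically uniform), and
  the basic boundedness theorem `wnorm (s - m) (kerOp K F) ≤ schurConst · wnorm s F`
  ("an operator of order `m` maps `H^s` to `H^{s-m}`", Taylor 1981, Ch. II §6 for genuine
  pseudo-differential operators; here an elementary instance).

## Design

* The weights need only a norm; the measure-theoretic statements are for a finite-dimensional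
  real inner product space `V` with its Lebesgue measure `volume`; `n = finrank ℝ V`.
* Norms are `ℝ≥0∞`-valued so that no finiteness hypothesis is needed to state bounds; constants
  are explicit real numbers wrapped in `ENNReal.ofReal`.
* `kerOp` is a Bochner integral (junk value `0` where the integrand is not integrable); the
  boundedness theorem is nevertheless unconditional, because `‖∫ f‖ₑ ≤ ∫⁻ ‖f‖ₑ` always holds.

## References

* M. E. Taylor, *Pseudodifferential Operators*, Princeton Univ. Press (1981), Ch. II §6
  (`L²` and Sobolev boundedness), Ch. XV §1 (Kohn's proof of Hörmander's theorem).
* J. Peetre's inequality: folklore (e.g. Hörmander, *ALPDO I*, (10.1.6')).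
-/

noncomputable section

open MeasureTheory Set Filter Function
open scoped ENNReal NNReal Topology

namespace Literature.Analysis.Hypoelliptic

/-! ### The weights `⟨ξ⟩^s` -/

section Weights

variable {V : Type*} [NormedAddCommGroup V]

/-- The Japanese-bracket weight of order `s`: `bw s ξ = (1 + ‖ξ‖²)^{s/2} = ⟨ξ⟩^s`. [folklore] -/
def bw (s : ℝ) (ξ : V) : ℝ :=
  (1 + ‖ξ‖ ^ 2) ^ (s / 2)

/-- `1 + ‖ξ‖² > 0`. [folklore] -/
theorem one_add_norm_sq_pos (ξ : V) : 0 < 1 + ‖ξ‖ ^ 2 := by positivity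

/-- `1 ≤ 1 + ‖ξ‖²`. [folklore] -/
theorem one_le_one_add_norm_sq (ξ : V) : 1 ≤ 1 + ‖ξ‖ ^ 2 := by nlinarith [norm_nonneg ξ]

/-- Unfolding `bw`. [folklore] -/
theorem bw_def (s : ℝ) (ξ : V) : bw s ξ = (1 + ‖ξ‖ ^ 2) ^ (s / 2) := rfl

/-- `⟨ξ⟩^s > 0`. [folklore] -/
theorem bw_pos (s : ℝ) (ξ : V) : 0 < bw s ξ := Real.rpow_pos_of_pos (one_add_norm_sq_pos ξ) _

/-- `⟨ξ⟩^s ≥ 0`. [folklore] -/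
theorem bw_nonneg (s : ℝ) (ξ : V) : 0 ≤ bw s ξ := (bw_pos s ξ).le

/-- `⟨ξ⟩^0 = 1`. [folklore] -/
@[simp] theorem bw_zero (ξ : V) : bw 0 ξ = 1 := by simp [bw]

/-- `⟨ξ⟩^{s+t} = ⟨ξ⟩^s ⟨ξ⟩^t`. [folklore] -/
theorem bw_add (s t : ℝ) (ξ : V) : bw (s + t) ξ = bw s ξ * bw t ξ := by
  rw [bw, bw, bw, add_div, Real.rpow_add (one_add_norm_sq_pos ξ)]

/-- `⟨ξ⟩^{-s} = (⟨ξ⟩^s)⁻¹`. [folklore] -/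
theorem bw_neg (s : ℝ) (ξ : V) : bw (-s) ξ = (bw s ξ)⁻¹ := by
  rw [bw, bw, neg_div, Real.rpow_neg (one_add_norm_sq_pos ξ).le]

/-- `⟨ξ⟩^s ⟨ξ⟩^{-s} = 1`. [folklore] -/
theorem bw_mul_bw_neg (s : ℝ) (ξ : V) : bw s ξ * bw (-s) ξ = 1 := by
  rw [bw_neg, mul_inv_cancel₀ (bw_pos s ξ).ne']

/-- `⟨ξ⟩^{s-t} = ⟨ξ⟩^s ⟨ξ⟩^{-t}`. [folklore] -/
theorem bw_sub (s t : ℝ) (ξ : V) : bw (s - t) ξ = bw s ξ * bw (-t) ξ := by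
  rw [sub_eq_add_neg, bw_add]

/-- `⟨-ξ⟩^s = ⟨ξ⟩^s`. [folklore] -/
@[simp] theorem bw_neg_arg (s : ℝ) (ξ : V) : bw s (-ξ) = bw s ξ := by simp [bw]

/-- `⟨ξ - η⟩^s = ⟨η - ξ⟩^s`. [folklore] -/
theorem bw_sub_comm (s : ℝ) (ξ η : V) : bw s (ξ - η) = bw s (η - ξ) := by
  rw [← neg_sub, bw_neg_arg]

/-- `1 ≤ ⟨ξ⟩^s` for `s ≥ 0`. [folklore] -/
theorem one_le_bw {s : ℝ} (hs : 0 ≤ s) (ξ : V) : 1 ≤ bw s ξ :=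
  Real.one_le_rpow (one_le_one_add_norm_sq ξ) (by linarith)

/-- `⟨ξ⟩^s ≤ 1` for `s ≤ 0`. [folklore] -/
theorem bw_le_one {s : ℝ} (hs : s ≤ 0) (ξ : V) : bw s ξ ≤ 1 :=
  Real.rpow_le_one_of_one_le_of_nonpos (one_le_one_add_norm_sq ξ) (by linarith)

/-- `⟨ξ⟩^s` is monotone in `s`. [folklore] -/
theorem bw_mono {s t : ℝ} (h : s ≤ t) (ξ : V) : bw s ξ ≤ bw t ξ :=
  Real.rpow_le_rpow_of_exponent_le (one_le_one_add_norm_sq ξ) (by linarith)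

/-- `⟨ξ⟩² = 1 + ‖ξ‖²`. [folklore] -/
theorem bw_two (ξ : V) : bw 2 ξ = 1 + ‖ξ‖ ^ 2 := by
  rw [bw, show (2 : ℝ) / 2 = 1 by norm_num, Real.rpow_one]

/-- `⟨ξ⟩ = √(1 + ‖ξ‖²)`. [folklore] -/
theorem bw_one (ξ : V) : bw 1 ξ = Real.sqrt (1 + ‖ξ‖ ^ 2) := by
  rw [bw, Real.sqrt_eq_rpow]

/-- `‖ξ‖ ≤ ⟨ξ⟩`. [folklore] -/
theorem norm_le_bw_one (ξ : V) : ‖ξ‖ ≤ bw 1 ξ := by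
  rw [bw_one]
  calc ‖ξ‖ = Real.sqrt (‖ξ‖ ^ 2) := (Real.sqrt_sq (norm_nonneg ξ)).symm
    _ ≤ Real.sqrt (1 + ‖ξ‖ ^ 2) := Real.sqrt_le_sqrt (by linarith)

/-- `⟨ξ⟩ ≤ 1 + ‖ξ‖`. [folklore] -/
theorem bw_one_le (ξ : V) : bw 1 ξ ≤ 1 + ‖ξ‖ := by
  rw [bw_one]
  exact sqrt_one_add_norm_sq_le ξ

/-- `1 ≤ ⟨ξ⟩`. [folklore] -/
theorem one_le_bw_one (ξ : V) : 1 ≤ bw 1 ξ := one_le_bw zero_le_one ξ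

/-- `⟨ξ⟩^{st} = (⟨ξ⟩^s)^t`. [folklore] -/
theorem bw_mul (s t : ℝ) (ξ : V) : bw (s * t) ξ = bw s ξ ^ t := by
  rw [bw, bw, ← Real.rpow_mul (one_add_norm_sq_pos ξ).le]
  congr 1
  ring

/-- `bw k ξ = (bw 1 ξ)^k` for natural `k`. [folklore] -/
theorem bw_natCast (k : ℕ) (ξ : V) : bw k ξ = bw 1 ξ ^ k := by
  rw [← Real.rpow_natCast, ← bw_mul, one_mul]

/-- `⟨ξ⟩^s` is continuous in `ξ`. [folklore] -/
@[fun_prop] theorem continuous_bw (s : ℝ) : Continuous (bw (V := V) s) := by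
  unfold bw
  exact Continuous.rpow_const (by fun_prop) fun ξ => Or.inl (one_add_norm_sq_pos ξ).ne'

/-! ### Peetre's inequality -/

/-- `1 + ‖ξ + η‖² ≤ 2 (1 + ‖ξ‖²)(1 + ‖η‖²)`. [folklore] -/
theorem one_add_norm_sq_add_le (ξ η : V) :
    1 + ‖ξ + η‖ ^ 2 ≤ 2 * (1 + ‖ξ‖ ^ 2) * (1 + ‖η‖ ^ 2) := by
  have h := norm_add_le ξ η
  have h2 : ‖ξ + η‖ ^ 2 ≤ (‖ξ‖ + ‖η‖) ^ 2 := pow_le_pow_left₀ (norm_nonneg _) h 2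
  nlinarith [sq_nonneg (‖ξ‖ - ‖η‖), mul_nonneg (norm_nonneg ξ) (norm_nonneg η),
    sq_nonneg (‖ξ‖ * ‖η‖)]

/-- Peetre's inequality for nonnegative exponents:
`⟨ξ + η⟩^s ≤ 2^{s/2} ⟨ξ⟩^s ⟨η⟩^s` (`s ≥ 0`). [folklore] -/
theorem peetre_of_nonneg {s : ℝ} (hs : 0 ≤ s) (ξ η : V) :
    bw s (ξ + η) ≤ 2 ^ (s / 2) * bw s ξ * bw s η := by
  have hs2 : 0 ≤ s / 2 := by linarith
  calc bw s (ξ + η) = (1 + ‖ξ + η‖ ^ 2) ^ (s / 2) := rfl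
    _ ≤ (2 * (1 + ‖ξ‖ ^ 2) * (1 + ‖η‖ ^ 2)) ^ (s / 2) :=
        Real.rpow_le_rpow (one_add_norm_sq_pos _).le (one_add_norm_sq_add_le ξ η) hs2
    _ = 2 ^ (s / 2) * bw s ξ * bw s η := by
        rw [Real.mul_rpow (by positivity) (one_add_norm_sq_pos η).le,
          Real.mul_rpow (by norm_num) (one_add_norm_sq_pos ξ).le, bw, bw]

/-- **Peetre's inequality**: `⟨ξ + η⟩^s ≤ 2^{|s|/2} ⟨ξ⟩^s ⟨η⟩^{|s|}` for every real `s`.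
[folklore] -/
theorem peetre (s : ℝ) (ξ η : V) : bw s (ξ + η) ≤ 2 ^ (|s| / 2) * bw s ξ * bw |s| η := by
  rcases le_or_gt 0 s with hs | hs
  · rw [abs_of_nonneg hs]
    exact peetre_of_nonneg hs ξ η
  · -- apply the nonnegative case to `ξ = (ξ + η) + (-η)` with exponent `-s`, then invert
    have hs' : 0 ≤ -s := by linarith
    have h := peetre_of_nonneg hs' (ξ + η) (-η)
    rw [add_neg_cancel_right, bw_neg_arg] at h
    rw [abs_of_neg hs]
    have hnn : 0 ≤ bw s ξ * bw s (ξ + η) := mul_nonneg (bw_nonneg _ _) (bw_nonneg _ _)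
    calc bw s (ξ + η) = bw (-s) ξ * (bw s ξ * bw s (ξ + η)) := by
          rw [← mul_assoc, mul_comm (bw (-s) ξ), bw_mul_bw_neg, one_mul]
      _ ≤ (2 ^ (-s / 2) * bw (-s) (ξ + η) * bw (-s) η) * (bw s ξ * bw s (ξ + η)) :=
          mul_le_mul_of_nonneg_right h hnn
      _ = 2 ^ (-s / 2) * bw s ξ * bw (-s) η * (bw s (ξ + η) * bw (-s) (ξ + η)) := by ring
      _ = 2 ^ (-s / 2) * bw s ξ * bw (-s) η := by rw [bw_mul_bw_neg, mul_one]

/-- Peetre, difference form: `⟨ξ⟩^s ≤ 2^{|s|/2} ⟨η⟩^s ⟨ξ - η⟩^{|s|}`. [folklore] -/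
theorem bw_le_bw_mul_bw_sub (s : ℝ) (ξ η : V) :
    bw s ξ ≤ 2 ^ (|s| / 2) * bw s η * bw |s| (ξ - η) := by
  have h := peetre s η (ξ - η)
  rwa [add_sub_cancel] at h

/-- Peetre, difference form with the roles exchanged:
`⟨η⟩^s ≤ 2^{|s|/2} ⟨ξ⟩^s ⟨ξ - η⟩^{|s|}`. [folklore] -/
theorem bw_le_bw_mul_bw_sub' (s : ℝ) (ξ η : V) :
    bw s η ≤ 2 ^ (|s| / 2) * bw s ξ * bw |s| (ξ - η) := by
  rw [bw_sub_comm]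
  exact bw_le_bw_mul_bw_sub s η ξ

/-- Peetre for the decay weights: `⟨ξ - ζ⟩^{-N} ⟨ζ - η⟩^{-N} ≤ 2^{N/2} ⟨ξ - η⟩^{-N}` (`N ≥ 0`).
[folklore] -/
theorem bw_neg_mul_bw_neg_le {N : ℝ} (hN : 0 ≤ N) (ξ ζ η : V) :
    bw (-N) (ξ - ζ) * bw (-N) (ζ - η) ≤ 2 ^ (N / 2) * bw (-N) (ξ - η) := by
  have h := peetre_of_nonneg hN (ξ - ζ) (ζ - η)
  rw [sub_add_sub_cancel] at h
  have hnn : 0 ≤ bw (-N) (ξ - ζ) * bw (-N) (ζ - η) * bw (-N) (ξ - η) :=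
    mul_nonneg (mul_nonneg (bw_nonneg _ _) (bw_nonneg _ _)) (bw_nonneg _ _)
  calc bw (-N) (ξ - ζ) * bw (-N) (ζ - η)
      = bw N (ξ - η) * (bw (-N) (ξ - ζ) * bw (-N) (ζ - η) * bw (-N) (ξ - η)) := by
        calc bw (-N) (ξ - ζ) * bw (-N) (ζ - η)
            = (bw N (ξ - η) * bw (-N) (ξ - η)) * (bw (-N) (ξ - ζ) * bw (-N) (ζ - η)) := by
              rw [bw_mul_bw_neg, one_mul]
          _ = _ := by ring
    _ ≤ (2 ^ (N / 2) * bw N (ξ - ζ) * bw N (ζ - η)) *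
          (bw (-N) (ξ - ζ) * bw (-N) (ζ - η) * bw (-N) (ξ - η)) :=
        mul_le_mul_of_nonneg_right h hnn
    _ = 2 ^ (N / 2) * bw (-N) (ξ - η) * (bw N (ξ - ζ) * bw (-N) (ξ - ζ)) *
          (bw N (ζ - η) * bw (-N) (ζ - η)) := by ring
    _ = 2 ^ (N / 2) * bw (-N) (ξ - η) := by rw [bw_mul_bw_neg, bw_mul_bw_neg, mul_one, mul_one]

/-- `‖(⟨ξ⟩^s : ℂ) z‖ₑ = ⟨ξ⟩^s ‖z‖ₑ`. [folklore] -/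
theorem enorm_bw_mul (s : ℝ) (ξ : V) (z : ℂ) :
    ‖(bw s ξ : ℂ) * z‖ₑ = ENNReal.ofReal (bw s ξ) * ‖z‖ₑ := by
  rw [enorm_mul, ← ofReal_norm (bw s ξ : ℂ), Complex.norm_real,
    Real.norm_of_nonneg (bw_nonneg s ξ)]

end Weights

/-- `‖(c : ℂ)‖ₑ = ENNReal.ofReal c` for `c ≥ 0` (the same one-liner exists as
`Literature.Analysis.FluidPDE.enorm_complex_ofReal_of_nonneg` in `KatoViscosityScaling.lean`;
restated here to avoid a heavy cross-topic import). [folklore] -/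
theorem enorm_ofReal_of_nonneg {c : ℝ} (hc : 0 ≤ c) : ‖(c : ℂ)‖ₑ = ENNReal.ofReal c := by
  rw [← ofReal_norm (c : ℂ), Complex.norm_real, Real.norm_of_nonneg hc]

/-! ### `ℝ≥0∞` square roots -/

/-- `(x^{1/2})² = x` in `ℝ≥0∞` (the same one-liner exists as
`Literature.Analysis.FluidPDE.LinearDeformation.rpow_inv_two_sq` in
`ForwardDSSApproximation.lean`; restated here to avoid a heavy cross-topic import). [folklore] -/
theorem ENNReal.rpow_inv_two_sq (x : ℝ≥0∞) : (x ^ (2⁻¹ : ℝ)) ^ 2 = x := by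
  rw [← ENNReal.rpow_two, ← ENNReal.rpow_mul, show (2⁻¹ : ℝ) * 2 = 1 by norm_num,
    ENNReal.rpow_one]

/-- `(x²)^{1/2} = x` in `ℝ≥0∞`. [folklore] -/
theorem ENNReal.sq_rpow_inv_two (x : ℝ≥0∞) : (x ^ 2) ^ (2⁻¹ : ℝ) = x := by
  rw [← ENNReal.rpow_two, ← ENNReal.rpow_mul, show (2 : ℝ) * 2⁻¹ = 1 by norm_num,
    ENNReal.rpow_one]

/-! ### Integrability of the weights -/

section DecayIndex

variable (V : Type*) [NormedAddCommGroup V] [InnerProductSpace ℝ V]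

/-- The canonical decay index used for an operator between two weight levels differing by `a`:
`N₀ = ⌈|a|⌉ + n + 1`, so that `|a| - N₀ < -n`. [folklore] -/
def decayIndex (a : ℝ) : ℕ :=
  ⌈|a|⌉₊ + Module.finrank ℝ V + 1

/-- `|a| - N₀ < -n`. [folklore] -/
theorem abs_sub_decayIndex_lt (a : ℝ) :
    |a| - (decayIndex V a : ℝ) < -(Module.finrank ℝ V : ℝ) := by
  unfold decayIndex
  push_cast
  have := Nat.le_ceil |a|
  linarith

end DecayIndex

section Measurable

variable {V : Type*} [NormedAddCommGroup V] [MeasurableSpace V] [OpensMeasurableSpace V]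

/-- `⟨ξ⟩^s` is measurable. [folklore] -/
@[fun_prop] theorem measurable_bw (s : ℝ) : Measurable (bw (V := V) s) :=
  (continuous_bw s).measurable

end Measurable

section Measure

variable {V : Type*} [NormedAddCommGroup V] [InnerProductSpace ℝ V] [FiniteDimensional ℝ V]
  [MeasurableSpace V] [BorelSpace V]

/-- `∫ ⟨ξ⟩^{-r} dξ < ∞` for `r > n = dim V`. [folklore] -/
theorem lintegral_bw_neg_lt_top {r : ℝ} (hr : (Module.finrank ℝ V : ℝ) < r) :
    ∫⁻ ξ : V, ENNReal.ofReal (bw (-r) ξ) < ∞ := by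
  have h := (integrable_rpow_neg_one_add_norm_sq (μ := (volume : Measure V)) hr).hasFiniteIntegral
  rw [hasFiniteIntegral_iff_ofReal] at h
  · simpa [bw, neg_div] using h
  · exact Eventually.of_forall fun ξ => Real.rpow_nonneg (one_add_norm_sq_pos ξ).le _

/-- `∫ ⟨ξ⟩^{s} dξ < ∞` for `s < -n`. [folklore] -/
theorem lintegral_bw_lt_top {s : ℝ} (hs : s < -(Module.finrank ℝ V : ℝ)) :
    ∫⁻ ξ : V, ENNReal.ofReal (bw s ξ) < ∞ := by
  have h := lintegral_bw_neg_lt_top (V := V) (r := -s) (by linarith)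
  simpa using h

/-- The integral `∫ ⟨ζ⟩^{|a| - N₀} dζ` is finite. [folklore] -/
theorem lintegral_bw_decayIndex_lt_top (a : ℝ) :
    ∫⁻ ζ : V, ENNReal.ofReal (bw (|a| - decayIndex V a) ζ) < ∞ :=
  lintegral_bw_lt_top (abs_sub_decayIndex_lt V a)

/-! ### The weighted `L²` norms -/

/-- The weighted `L²` norm of order `s` of a function on the Fourier side,
`wnorm s F = ‖⟨ξ⟩^s F‖_{L²(dξ)} ∈ ℝ≥0∞`: for `F = 𝓕u` this is the Sobolev norm `‖u‖_{H^s}`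
(Taylor 1981, Ch. I; Hörmander 1967, p. 153). [folklore] -/
def wnorm (s : ℝ) (F : V → ℂ) : ℝ≥0∞ :=
  eLpNorm (fun ξ => (bw s ξ : ℂ) * F ξ) 2 volume

/-- The weighted norm as a Lebesgue integral:
`wnorm s F = (∫ (⟨ξ⟩^s ‖F ξ‖)² dξ)^{1/2}`. [folklore] -/
theorem wnorm_eq_lintegral (s : ℝ) (F : V → ℂ) :
    wnorm s F = (∫⁻ ξ, (ENNReal.ofReal (bw s ξ) * ‖F ξ‖ₑ) ^ 2) ^ (2⁻¹ : ℝ) := by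
  rw [wnorm, eLpNorm_eq_lintegral_rpow_enorm_toReal two_ne_zero ENNReal.ofNat_ne_top]
  simp only [ENNReal.toReal_ofNat, one_div]
  congr 1
  refine lintegral_congr fun ξ => ?_
  rw [enorm_bw_mul, ENNReal.rpow_two]

/-- The square of the weighted norm: `(wnorm s F)² = ∫ (⟨ξ⟩^s ‖F ξ‖)² dξ`. [folklore] -/
theorem wnorm_sq (s : ℝ) (F : V → ℂ) :
    wnorm s F ^ 2 = ∫⁻ ξ, (ENNReal.ofReal (bw s ξ) * ‖F ξ‖ₑ) ^ 2 := by
  rw [wnorm_eq_lintegral, ENNReal.rpow_inv_two_sq]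

/-- The weighted norms only see the function almost everywhere. [folklore] -/
theorem wnorm_congr_ae {s : ℝ} {F G : V → ℂ} (h : F =ᵐ[volume] G) : wnorm s F = wnorm s G :=
  eLpNorm_congr_ae (h.mono fun ξ hξ => by simp [hξ])

/-- Monotonicity of the weighted norms in the order: `wnorm s F ≤ wnorm t F` for `s ≤ t`.
[folklore] -/
theorem wnorm_mono {s t : ℝ} (h : s ≤ t) (F : V → ℂ) : wnorm s F ≤ wnorm t F := by
  refine eLpNorm_mono_enorm fun ξ => ?_
  rw [enorm_bw_mul, enorm_bw_mul]
  exact mul_le_mul' (ENNReal.ofReal_le_ofReal (bw_mono h ξ)) le_rfl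

/-- Pointwise domination gives domination of weighted norms. [folklore] -/
theorem wnorm_le_of_enorm_le {s : ℝ} {F G : V → ℂ} (h : ∀ ξ, ‖F ξ‖ₑ ≤ ‖G ξ‖ₑ) :
    wnorm s F ≤ wnorm s G := by
  refine eLpNorm_mono_enorm fun ξ => ?_
  rw [enorm_bw_mul, enorm_bw_mul]
  exact mul_le_mul' le_rfl (h ξ)

/-- Shifting the weight: `wnorm s (⟨·⟩^t F) = wnorm (s + t) F`. [folklore] -/
theorem wnorm_bw_mul (s t : ℝ) (F : V → ℂ) :
    wnorm s (fun ξ => (bw t ξ : ℂ) * F ξ) = wnorm (s + t) F := by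
  unfold wnorm
  congr 1
  ext ξ
  rw [← mul_assoc, ← Complex.ofReal_mul, bw_add]

/-- Homogeneity of the weighted norms. [folklore] -/
theorem wnorm_const_mul (s : ℝ) (c : ℂ) (F : V → ℂ) :
    wnorm s (fun ξ => c * F ξ) = ‖c‖ₑ * wnorm s F := by
  unfold wnorm
  rw [← eLpNorm_const_smul c]
  congr 1
  ext ξ
  simp only [Pi.smul_apply, smul_eq_mul]
  ring

/-- `wnorm s (-F) = wnorm s F`. [folklore] -/
theorem wnorm_neg (s : ℝ) (F : V → ℂ) : wnorm s (fun ξ => -F ξ) = wnorm s F := by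
  have := wnorm_const_mul s (-1) F
  simpa using this

/-- `wnorm s (-F) = wnorm s F` (for the `Pi` negation). [folklore] -/
theorem wnorm_neg' (s : ℝ) (F : V → ℂ) : wnorm s (-F) = wnorm s F := wnorm_neg s F

/-- `wnorm s 0 = 0`. [folklore] -/
@[simp] theorem wnorm_zero_fun (s : ℝ) : wnorm s (fun _ : V => (0 : ℂ)) = 0 := by
  simp [wnorm]

/-- A multiplier of order `m` with constant `c`: `‖φ ξ‖ ≤ c ⟨ξ⟩^m` pointwise gives
`wnorm (s - m) (φ F) ≤ c · wnorm s F`. [folklore] -/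
theorem wnorm_mul_le {φ : V → ℂ} {m c : ℝ} (hc : 0 ≤ c) (hφ : ∀ ξ, ‖φ ξ‖ ≤ c * bw m ξ) (s : ℝ)
    (F : V → ℂ) : wnorm (s - m) (fun ξ => φ ξ * F ξ) ≤ ENNReal.ofReal c * wnorm s F := by
  calc wnorm (s - m) (fun ξ => φ ξ * F ξ)
      ≤ wnorm (s - m) (fun ξ => (c : ℂ) * ((bw m ξ : ℂ) * F ξ)) := by
        refine wnorm_le_of_enorm_le fun ξ => ?_
        rw [enorm_mul, enorm_mul, enorm_bw_mul, enorm_ofReal_of_nonneg hc, ← mul_assoc,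
          ← ENNReal.ofReal_mul hc, ← ofReal_norm]
        exact mul_le_mul' (ENNReal.ofReal_le_ofReal (hφ ξ)) le_rfl
    _ = ENNReal.ofReal c * wnorm (s - m + m) F := by
        rw [wnorm_const_mul, wnorm_bw_mul, enorm_ofReal_of_nonneg hc]
    _ = ENNReal.ofReal c * wnorm s F := by rw [sub_add_cancel]

/-- Triangle inequality for the weighted norms. [folklore] -/
theorem wnorm_add_le {s : ℝ} {F G : V → ℂ} (hF : AEStronglyMeasurable F volume)
    (hG : AEStronglyMeasurable G volume) :
    wnorm s (fun ξ => F ξ + G ξ) ≤ wnorm s F + wnorm s G := by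
  unfold wnorm
  have hw : AEStronglyMeasurable (fun ξ : V => (bw s ξ : ℂ)) volume :=
    (Complex.continuous_ofReal.comp (continuous_bw s)).aestronglyMeasurable
  calc eLpNorm (fun ξ => (bw s ξ : ℂ) * (F ξ + G ξ)) 2 volume
      = eLpNorm ((fun ξ => (bw s ξ : ℂ) * F ξ) + fun ξ => (bw s ξ : ℂ) * G ξ) 2 volume := by
        congr 1; ext ξ; simp [mul_add]
    _ ≤ _ := eLpNorm_add_le (hw.mul hF) (hw.mul hG) one_le_two

/-- Triangle inequality for differences. [folklore] -/
theorem wnorm_sub_le {s : ℝ} {F G : V → ℂ} (hF : AEStronglyMeasurable F volume)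
    (hG : AEStronglyMeasurable G volume) :
    wnorm s (fun ξ => F ξ - G ξ) ≤ wnorm s F + wnorm s G := by
  have h := wnorm_add_le (s := s) hF hG.neg
  rw [wnorm_neg'] at h
  simpa [sub_eq_add_neg] using h

/-! ### The Schur test -/

/-- **Cauchy–Schwarz for a kernel row**:
`(∫ k(η) G(η) dη)² ≤ (∫ k(η) dη) (∫ k(η) G(η)² dη)`. [folklore] -/
theorem lintegral_mul_sq_le {k G : V → ℝ≥0∞} (hk : Measurable k) (hG : Measurable G) :
    (∫⁻ η, k η * G η) ^ 2 ≤ (∫⁻ η, k η) * ∫⁻ η, k η * G η ^ 2 := by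
  -- Hölder with exponents `2, 2` applied to `k^{1/2}` and `k^{1/2} G`
  have hH := ENNReal.lintegral_mul_le_Lp_mul_Lq volume Real.HolderConjugate.two_two
    (f := fun η => k η ^ (2⁻¹ : ℝ)) (g := fun η => k η ^ (2⁻¹ : ℝ) * G η)
    (by fun_prop) (by fun_prop)
  have h1 : (fun η => k η ^ (2⁻¹ : ℝ)) * (fun η => k η ^ (2⁻¹ : ℝ) * G η) =
      fun η => k η * G η := by
    ext η
    simp only [Pi.mul_apply]
    rw [← mul_assoc, ← ENNReal.rpow_add_of_nonneg _ _ (by norm_num) (by norm_num),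
      show (2⁻¹ : ℝ) + 2⁻¹ = 1 by norm_num, ENNReal.rpow_one]
  have h2 : ∀ η, (k η ^ (2⁻¹ : ℝ)) ^ (2 : ℝ) = k η := fun η => by
    rw [← ENNReal.rpow_mul, show (2⁻¹ : ℝ) * 2 = 1 by norm_num, ENNReal.rpow_one]
  have h3 : ∀ η, (k η ^ (2⁻¹ : ℝ) * G η) ^ (2 : ℝ) = k η * G η ^ 2 := fun η => by
    rw [ENNReal.mul_rpow_of_nonneg _ _ (by norm_num), h2, ENNReal.rpow_two]
  rw [h1] at hH
  simp only [h2, h3, one_div] at hH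
  calc (∫⁻ η, k η * G η) ^ 2
      ≤ ((∫⁻ η, k η) ^ (2⁻¹ : ℝ) * (∫⁻ η, k η * G η ^ 2) ^ (2⁻¹ : ℝ)) ^ 2 :=
        pow_le_pow_left' hH 2
    _ = (∫⁻ η, k η) * ∫⁻ η, k η * G η ^ 2 := by
        rw [mul_pow, ENNReal.rpow_inv_two_sq, ENNReal.rpow_inv_two_sq]

/-- **The Schur test** (Lebesgue-integral form). If the nonnegative kernel `K` has row integrals
`≤ A` and column integrals `≤ B`, then `∫ (∫ K(ξ,η) G(η) dη)² dξ ≤ A B ∫ G²`, i.e. the integral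
operator of kernel `K` has norm `≤ √(AB)` on `L²`. [folklore] -/
theorem schur_test {K : V → V → ℝ≥0∞} (hK : Measurable (uncurry K)) {A B : ℝ≥0∞}
    (hA : ∀ ξ, ∫⁻ η, K ξ η ≤ A) (hB : ∀ η, ∫⁻ ξ, K ξ η ≤ B) {G : V → ℝ≥0∞}
    (hG : Measurable G) :
    ∫⁻ ξ, (∫⁻ η, K ξ η * G η) ^ 2 ≤ A * B * ∫⁻ η, G η ^ 2 := by
  have hrow : ∀ ξ, (∫⁻ η, K ξ η * G η) ^ 2 ≤ A * ∫⁻ η, K ξ η * G η ^ 2 := fun ξ =>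
    (lintegral_mul_sq_le hK.of_uncurry_left hG).trans (mul_le_mul' (hA ξ) le_rfl)
  have hm : Measurable (uncurry fun ξ η => K ξ η * G η ^ 2) :=
    hK.mul ((hG.pow_const 2).comp measurable_snd)
  calc ∫⁻ ξ, (∫⁻ η, K ξ η * G η) ^ 2 ≤ ∫⁻ ξ, A * ∫⁻ η, K ξ η * G η ^ 2 := lintegral_mono hrow
    _ = A * ∫⁻ ξ, ∫⁻ η, K ξ η * G η ^ 2 := by
        rw [lintegral_const_mul'' _ hm.lintegral_prod_right.aemeasurable]
    _ = A * ∫⁻ η, ∫⁻ ξ, K ξ η * G η ^ 2 := by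
        rw [lintegral_lintegral_swap (μ := volume) (ν := volume) hm.aemeasurable]
    _ = A * ∫⁻ η, (∫⁻ ξ, K ξ η) * G η ^ 2 := by
        congr 1
        exact lintegral_congr fun η =>
          lintegral_mul_const'' _ hK.of_uncurry_right.aemeasurable
    _ ≤ A * ∫⁻ η, B * G η ^ 2 := by
        refine mul_le_mul' le_rfl (lintegral_mono fun η => ?_)
        exact mul_le_mul' (hB η) le_rfl
    _ = A * B * ∫⁻ η, G η ^ 2 := by
        rw [lintegral_const_mul'' _ (hG.pow_const 2).aemeasurable, mul_assoc]

/-- The Schur test for a **convolution-dominated kernel**: if `K(ξ, η) ≤ k(ξ - η)` then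
`∫ (∫ K G)² ≤ (∫ k)² ∫ G²`. [folklore] -/
theorem schur_test_conv {K : V → V → ℝ≥0∞} (hK : Measurable (uncurry K)) {k : V → ℝ≥0∞}
    (hKk : ∀ ξ η, K ξ η ≤ k (ξ - η)) {G : V → ℝ≥0∞} (hG : Measurable G) :
    ∫⁻ ξ, (∫⁻ η, K ξ η * G η) ^ 2 ≤ (∫⁻ ζ, k ζ) ^ 2 * ∫⁻ η, G η ^ 2 := by
  rw [sq (∫⁻ ζ, k ζ)]
  refine schur_test hK (fun ξ => ?_) (fun η => ?_) hG
  · calc ∫⁻ η, K ξ η ≤ ∫⁻ η, k (ξ - η) := lintegral_mono fun η => hKk ξ η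
      _ = ∫⁻ ζ, k ζ := lintegral_sub_left_eq_self k ξ
  · calc ∫⁻ ξ, K ξ η ≤ ∫⁻ ξ, k (ξ - η) := lintegral_mono fun ξ => hKk ξ η
      _ = ∫⁻ ζ, k ζ := lintegral_sub_right_eq_self k η

end Measure

/-! ### Kernel operators and their order -/

section KernelCert

variable {V : Type*} [NormedAddCommGroup V] [MeasurableSpace V]

/-- **Certificate "`K` is the kernel of an operator of order `m`"** with the explicit constant
function `C`: `K` is (jointly) measurable and, for every `N : ℕ`,
`‖K ξ η‖ ≤ C N · ⟨ξ - η⟩^{-N} · ⟨η⟩^m` with `C N ≥ 0` — rapid decay off the diagonal, growth of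
order `m`. Families of kernels certified with the same `C` are uniformly of order `m`.
[folklore] -/
structure KerDecay (K : V → V → ℂ) (m : ℝ) (C : ℕ → ℝ) : Prop where
  measurable : Measurable (uncurry K)
  nonneg : ∀ N, 0 ≤ C N
  bound : ∀ (N : ℕ) (ξ η : V), ‖K ξ η‖ ≤ C N * bw (-N) (ξ - η) * bw m η

namespace KerDecay

variable {K : V → V → ℂ} {m : ℝ} {C : ℕ → ℝ}

/-- A certified kernel is measurable in the second variable. [folklore] -/
theorem measurable_right (h : KerDecay K m C) (ξ : V) : Measurable (K ξ) :=
  h.measurable.of_uncurry_left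

/-- A certified kernel is measurable in the first variable. [folklore] -/
theorem measurable_left (h : KerDecay K m C) (η : V) : Measurable fun ξ => K ξ η :=
  h.measurable.of_uncurry_right

/-- Weakening the order: a kernel of order `m` is of order `m'` for `m ≤ m'`. [folklore] -/
theorem mono (h : KerDecay K m C) {m' : ℝ} (hm : m ≤ m') : KerDecay K m' C where
  measurable := h.measurable
  nonneg := h.nonneg
  bound N ξ η := (h.bound N ξ η).trans
    (mul_le_mul_of_nonneg_left (bw_mono hm η) (mul_nonneg (h.nonneg N) (bw_nonneg _ _)))

/-- Enlarging the constants. [folklore] -/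
theorem of_le (h : KerDecay K m C) {C' : ℕ → ℝ} (hC : ∀ N, C N ≤ C' N) : KerDecay K m C' where
  measurable := h.measurable
  nonneg N := (h.nonneg N).trans (hC N)
  bound N ξ η := (h.bound N ξ η).trans (mul_le_mul_of_nonneg_right
    (mul_le_mul_of_nonneg_right (hC N) (bw_nonneg _ _)) (bw_nonneg _ _))

/-- Scalar multiples of a certified kernel. [folklore] -/
theorem const_mul (h : KerDecay K m C) (c : ℂ) :
    KerDecay (fun ξ η => c * K ξ η) m (fun N => ‖c‖ * C N) where
  measurable := measurable_const.mul h.measurable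
  nonneg N := mul_nonneg (norm_nonneg c) (h.nonneg N)
  bound N ξ η := by
    rw [norm_mul, mul_assoc, mul_assoc]
    exact mul_le_mul_of_nonneg_left (by rw [← mul_assoc]; exact h.bound N ξ η) (norm_nonneg c)

/-- Sums of certified kernels of the same order. [folklore] -/
theorem add (h : KerDecay K m C) {K' : V → V → ℂ} {C' : ℕ → ℝ} (h' : KerDecay K' m C') :
    KerDecay (fun ξ η => K ξ η + K' ξ η) m (fun N => C N + C' N) where
  measurable := h.measurable.add h'.measurable
  nonneg N := add_nonneg (h.nonneg N) (h'.nonneg N)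
  bound N ξ η := (norm_add_le _ _).trans <| by
    rw [add_mul, add_mul]
    exact add_le_add (h.bound N ξ η) (h'.bound N ξ η)

/-- The negative of a certified kernel. [folklore] -/
theorem neg (h : KerDecay K m C) : KerDecay (fun ξ η => -K ξ η) m C where
  measurable := h.measurable.neg
  nonneg := h.nonneg
  bound N ξ η := by rw [norm_neg]; exact h.bound N ξ η

/-- Differences of certified kernels. [folklore] -/
theorem sub (h : KerDecay K m C) {K' : V → V → ℂ} {C' : ℕ → ℝ} (h' : KerDecay K' m C') :
    KerDecay (fun ξ η => K ξ η - K' ξ η) m (fun N => C N + C' N) := by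
  simpa [sub_eq_add_neg] using h.add h'.neg

/-- The zero kernel is of every order. [folklore] -/
theorem zero (m : ℝ) : KerDecay (fun _ _ : V => (0 : ℂ)) m (fun _ => 0) where
  measurable := measurable_const
  nonneg _ := le_rfl
  bound N ξ η := by simp

/-- The weighted kernel domination behind the boundedness theorem: for a kernel of order `m`,
`⟨ξ⟩^{s-m} ‖K ξ η‖ ≤ 2^{|s-m|/2} C N · ⟨ξ - η⟩^{|s-m|-N} · ⟨η⟩^s`. [folklore] -/
theorem weighted_bound (h : KerDecay K m C) (s : ℝ) (N : ℕ) (ξ η : V) :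
    bw (s - m) ξ * ‖K ξ η‖ ≤
      2 ^ (|s - m| / 2) * C N * bw (|s - m| - N) (ξ - η) * bw s η := by
  have hP := bw_le_bw_mul_bw_sub (s - m) ξ η
  have hnn : 0 ≤ 2 ^ (|s - m| / 2) * bw (s - m) η * bw |s - m| (ξ - η) :=
    mul_nonneg (mul_nonneg (by positivity) (bw_nonneg _ _)) (bw_nonneg _ _)
  calc bw (s - m) ξ * ‖K ξ η‖
      ≤ (2 ^ (|s - m| / 2) * bw (s - m) η * bw |s - m| (ξ - η)) *
          (C N * bw (-N) (ξ - η) * bw m η) :=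
        mul_le_mul hP (h.bound N ξ η) (norm_nonneg _) hnn
    _ = 2 ^ (|s - m| / 2) * C N * (bw |s - m| (ξ - η) * bw (-N) (ξ - η)) *
          (bw (s - m) η * bw m η) := by ring
    _ = 2 ^ (|s - m| / 2) * C N * bw (|s - m| - N) (ξ - η) * bw s η := by
        rw [← bw_add, ← bw_add, show |s - m| + -(N : ℝ) = |s - m| - N by ring,
          show s - m + m = s by ring]

end KerDecay

end KernelCert

section Kernel

variable {V : Type*} [NormedAddCommGroup V] [InnerProductSpace ℝ V] [FiniteDimensional ℝ V]
  [MeasurableSpace V] [BorelSpace V]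

/-- The integral operator of kernel `K` on the Fourier side:
`kerOp K F (ξ) = ∫ K ξ η * F η dη` (a Bochner integral; `0` where not integrable).
[folklore] -/
def kerOp (K : V → V → ℂ) (F : V → ℂ) (ξ : V) : ℂ :=
  ∫ η, K ξ η * F η

/-- The pointwise Lebesgue-integral bound behind the boundedness theorem:
`‖kerOp K F ξ‖ₑ ≤ ∫⁻ ‖K ξ η‖ₑ ‖F η‖ₑ dη` (no integrability needed). [folklore] -/
theorem enorm_kerOp_le (K : V → V → ℂ) (F : V → ℂ) (ξ : V) :
    ‖kerOp K F ξ‖ₑ ≤ ∫⁻ η, ‖K ξ η‖ₑ * ‖F η‖ₑ := by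
  refine (enorm_integral_le_lintegral_enorm _).trans (lintegral_mono fun η => ?_)
  rw [enorm_mul]

/-- `kerOp` only sees its argument almost everywhere. [folklore] -/
theorem kerOp_congr_ae (K : V → V → ℂ) {F G : V → ℂ} (h : F =ᵐ[volume] G) :
    kerOp K F = kerOp K G := by
  ext ξ
  exact integral_congr_ae (h.mono fun η hη => by simp [hη])

/-- The constant of the boundedness theorem for an operator of order `m` between the levels
`s` and `s - m` (`a = s - m`): `2^{|a|/2} · C N₀ · ∫ ⟨ζ⟩^{|a| - N₀} dζ`, `N₀ = decayIndex a`.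
[folklore] -/
def schurConst (V : Type*) [NormedAddCommGroup V] [InnerProductSpace ℝ V]
    [FiniteDimensional ℝ V] [MeasurableSpace V] [BorelSpace V] (a : ℝ) (C : ℕ → ℝ) : ℝ :=
  2 ^ (|a| / 2) * C (decayIndex V a) *
    (∫⁻ ζ : V, ENNReal.ofReal (bw (|a| - decayIndex V a) ζ)).toReal

/-- `schurConst ≥ 0` when `C ≥ 0`. [folklore] -/
theorem schurConst_nonneg {C : ℕ → ℝ} (hC : ∀ N, 0 ≤ C N) (a : ℝ) : 0 ≤ schurConst V a C :=
  mul_nonneg (mul_nonneg (by positivity) (hC _)) ENNReal.toReal_nonneg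

/-- **An operator of order `m` maps `H^s` to `H^{s-m}`** (Fourier side): for a kernel `K`
certified of order `m` with constants `C` and every a.e. strongly measurable `F`,
`wnorm (s - m) (kerOp K F) ≤ schurConst (s - m) C · wnorm s F`. (Taylor 1981, Ch. II §6, for
pseudo-differential operators; here the elementary Schur-test instance.) [folklore] -/
theorem wnorm_kerOp_le {K : V → V → ℂ} {m : ℝ} {C : ℕ → ℝ} (h : KerDecay K m C) (s : ℝ)
    {F : V → ℂ} (hF : AEStronglyMeasurable F volume) :
    wnorm (s - m) (kerOp K F) ≤ ENNReal.ofReal (schurConst V (s - m) C) * wnorm s F := by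
  -- replace `F` by a measurable modification
  obtain ⟨F', hF'm, hFF'⟩ := hF
  rw [kerOp_congr_ae K hFF', wnorm_congr_ae (s := s) hFF']
  have hF' : Measurable F' := hF'm.measurable
  -- notation
  set a : ℝ := s - m with ha
  set N : ℕ := decayIndex V a with hN
  set c₀ : ℝ := 2 ^ (|a| / 2) * C N with hc₀
  have hc₀nn : 0 ≤ c₀ := mul_nonneg (by positivity) (h.nonneg N)
  set k : V → ℝ≥0∞ := fun ζ => ENNReal.ofReal (c₀ * bw (|a| - N) ζ) with hk
  set G : V → ℝ≥0∞ := fun η => ENNReal.ofReal (bw s η) * ‖F' η‖ₑ with hG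
  have hGm : Measurable G :=
    (ENNReal.measurable_ofReal.comp (measurable_bw s)).mul hF'.enorm
  -- the dominating kernel
  set Kd : V → V → ℝ≥0∞ := fun ξ η => ENNReal.ofReal (bw a ξ) * ‖K ξ η‖ₑ *
    ENNReal.ofReal (bw (-s) η) with hKd
  have hKdm : Measurable (uncurry Kd) :=
    ((ENNReal.measurable_ofReal.comp ((measurable_bw a).comp measurable_fst)).mul
      h.measurable.enorm).mul (ENNReal.measurable_ofReal.comp ((measurable_bw (-s)).comp
        measurable_snd))
  have hKdk : ∀ ξ η, Kd ξ η ≤ k (ξ - η) := fun ξ η => by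
    simp only [hKd, hk]
    rw [← ofReal_norm, ← ENNReal.ofReal_mul (bw_nonneg a ξ),
      ← ENNReal.ofReal_mul (mul_nonneg (bw_nonneg a ξ) (norm_nonneg _))]
    refine ENNReal.ofReal_le_ofReal ?_
    have hw := h.weighted_bound s N ξ η
    calc bw a ξ * ‖K ξ η‖ * bw (-s) η
        ≤ (2 ^ (|a| / 2) * C N * bw (|a| - N) (ξ - η) * bw s η) * bw (-s) η :=
          mul_le_mul_of_nonneg_right hw (bw_nonneg _ _)
      _ = c₀ * bw (|a| - N) (ξ - η) * (bw s η * bw (-s) η) := by rw [hc₀]; ring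
      _ = c₀ * bw (|a| - N) (ξ - η) := by rw [bw_mul_bw_neg, mul_one]
  -- pointwise: weighted `kerOp` is dominated by `∫ Kd G`
  have h1 : ∀ η : V, ENNReal.ofReal (bw (-s) η) * ENNReal.ofReal (bw s η) = 1 := fun η => by
    rw [← ENNReal.ofReal_mul (bw_nonneg (-s) η), mul_comm, bw_mul_bw_neg, ENNReal.ofReal_one]
  have hpt : ∀ ξ, ENNReal.ofReal (bw a ξ) * ‖kerOp K F' ξ‖ₑ ≤ ∫⁻ η, Kd ξ η * G η := fun ξ => by
    calc ENNReal.ofReal (bw a ξ) * ‖kerOp K F' ξ‖ₑ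
        ≤ ENNReal.ofReal (bw a ξ) * ∫⁻ η, ‖K ξ η‖ₑ * ‖F' η‖ₑ :=
          mul_le_mul' le_rfl (enorm_kerOp_le K F' ξ)
      _ = ∫⁻ η, ENNReal.ofReal (bw a ξ) * (‖K ξ η‖ₑ * ‖F' η‖ₑ) := by
          rw [lintegral_const_mul' _ _ ENNReal.ofReal_ne_top]
      _ = ∫⁻ η, Kd ξ η * G η := lintegral_congr fun η => by
          simp only [hKd, hG]
          symm
          calc ENNReal.ofReal (bw a ξ) * ‖K ξ η‖ₑ * ENNReal.ofReal (bw (-s) η) *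
                (ENNReal.ofReal (bw s η) * ‖F' η‖ₑ)
              = ENNReal.ofReal (bw a ξ) * ‖K ξ η‖ₑ *
                  (ENNReal.ofReal (bw (-s) η) * ENNReal.ofReal (bw s η)) * ‖F' η‖ₑ := by ring
            _ = ENNReal.ofReal (bw a ξ) * (‖K ξ η‖ₑ * ‖F' η‖ₑ) := by
                rw [h1, mul_one, mul_assoc]
  -- Schur
  have hS := schur_test_conv hKdm hKdk hGm
  have hint : ∫⁻ ζ, k ζ = ENNReal.ofReal c₀ * ∫⁻ ζ : V, ENNReal.ofReal (bw (|a| - N) ζ) := by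
    have hmeas : Measurable fun ζ : V => ENNReal.ofReal (bw (|a| - N) ζ) :=
      ENNReal.measurable_ofReal.comp (measurable_bw _)
    simp only [hk]
    rw [← lintegral_const_mul'' _ hmeas.aemeasurable]
    exact lintegral_congr fun ζ => ENNReal.ofReal_mul hc₀nn
  have hIfin : ∫⁻ ζ : V, ENNReal.ofReal (bw (|a| - N) ζ) < ∞ := lintegral_bw_decayIndex_lt_top a
  -- assemble
  rw [wnorm_eq_lintegral, wnorm_eq_lintegral]
  have hsq : ∫⁻ ξ, (ENNReal.ofReal (bw a ξ) * ‖kerOp K F' ξ‖ₑ) ^ 2 ≤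
      (∫⁻ ζ, k ζ) ^ 2 * ∫⁻ η, G η ^ 2 :=
    (lintegral_mono fun ξ => pow_le_pow_left' (hpt ξ) 2).trans hS
  calc (∫⁻ ξ, (ENNReal.ofReal (bw a ξ) * ‖kerOp K F' ξ‖ₑ) ^ 2) ^ (2⁻¹ : ℝ)
      ≤ ((∫⁻ ζ, k ζ) ^ 2 * ∫⁻ η, G η ^ 2) ^ (2⁻¹ : ℝ) := ENNReal.rpow_le_rpow hsq (by norm_num)
    _ = (∫⁻ ζ, k ζ) * (∫⁻ η, G η ^ 2) ^ (2⁻¹ : ℝ) := by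
        rw [ENNReal.mul_rpow_of_nonneg _ _ (by norm_num), ENNReal.sq_rpow_inv_two]
    _ = ENNReal.ofReal (schurConst V a C) * (∫⁻ η, G η ^ 2) ^ (2⁻¹ : ℝ) := by
        rw [hint, schurConst, ← hN, ← hc₀, ENNReal.ofReal_mul hc₀nn,
          ENNReal.ofReal_toReal hIfin.ne]

/-- Existential form of the boundedness theorem: an operator with a kernel of order `m` is
bounded from level `s` to level `s - m` for every `s`. [folklore] -/
theorem KerDecay.exists_wnorm_kerOp_le {K : V → V → ℂ} {m : ℝ} {C : ℕ → ℝ} (h : KerDecay K m C)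
    (s : ℝ) : ∃ B : ℝ, 0 ≤ B ∧ ∀ F : V → ℂ, AEStronglyMeasurable F volume →
      wnorm (s - m) (kerOp K F) ≤ ENNReal.ofReal B * wnorm s F :=
  ⟨schurConst V (s - m) C, schurConst_nonneg h.nonneg _, fun _ hF => wnorm_kerOp_le h s hF⟩

end Kernel

end Literature.Analysis.Hypoelliptic
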